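import Summits.ABC.ABC.Theses.DefiniteXi
import Summits.ABC.ABC.Theses.IsogenyGlueCongruence
import Summits.ABC.ABC.Theorems.IsogenyGlueCongruenceMazurKenkuBoundOfRadius
import Summits.ABC.ABC.Theorems.IsogenyGlueCongruenceMazurKenkuBoundLevelTwenty
import Summits.ABC.ABC.Theorems.IsogenyGlueCongruenceMazurKenkuBoundLevelThirtyTwo
import Literature.NumberTheory.EllipticCurves.PastenSpectralDegree
import Literature.NumberTheory.EllipticCurves.ManinConstantArbitraryParametrizationIntegralProofs
import Literature.NumberTheory.EllipticCurves.RationalTwoTorsionModPIrreducibleProofs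
import Literature.NumberTheory.EllipticCurves.KenkuMinimalLevelsKleinFricke
import Literature.NumberTheory.EllipticCurves.PrimeDegreeIsogenyJTable
import Literature.NumberTheory.EllipticCurves.OpenImageMazurInputs
import HarnessLib

/-!
# STUB-IDEAS k3 scratch — `stub_pasten163` (crux `DefiniteRTControlPrime`, stmt-ABC-11338)

Helper statements for `STUB-IDEAS-stub_pasten163-3.md`. Plan A helpers are PROVED (bridges by
name); Plan B helpers are SIGNATURES (`sorry`) of the Frey-restricted reshape option.
-/

set_option linter.dupNamespace false

noncomputable section

open scoped Classical

namespace Summit.ABC.ABC.Cruxes.DefiniteRTControlPrime.StubIdeas3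

open Literature.NumberTheory.EllipticCurves Literature.NumberTheory.EllipticCurves.ModularForms
open WeierstrassCurve

/-! ## Plan A — import by name (the stub IS route item `MazurKenkuBound`, stmt-ABC-15125) -/

/-- A1: the stub's type is verbatim the body of `DefiniteXi.MazurKenkuBound` (aside item of this
route; crux r9 of `IsogenyGlueCongruence`, stmt-ABC-15125). -/
theorem A1_stub_iff_defXiItem :
    PastenShimura2024_minimalDegree_le_163_mul ↔ Summit.ABC.ABC.Theses.DefiniteXi.MazurKenkuBound :=
  Iff.rfl

/-- A1': … and of `IsogenyGlueCongruence.MazurKenkuBound` (the STAFFED copy, lead c23, line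
`radius-lite`: `MazurKenkuBound_of` in `Cruxes/MazurKenkuBound/Lines/radius_lite.lean`). -/
theorem A1'_stub_iff_igcItem :
    PastenShimura2024_minimalDegree_le_163_mul ↔
      Summit.ABC.ABC.Theses.IsogenyGlueCongruence.MazurKenkuBound :=
  Iff.rfl

/-- A2: the stub from the radius item `MazurKenkuRadius` (stmt-ABC-15193; same body in
`DefiniteXi`, `RibetTakahashiSplit`, `IsogenyGlueCongruence`) — landed join p135527 + Edixhoven
discharged. -/
theorem A2_stub_of_radiusItem (hRad : Summit.ABC.ABC.Theses.DefiniteXi.MazurKenkuRadius) :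
    PastenShimura2024_minimalDegree_le_163_mul :=
  Summit.ABC.ABC.Theorems.mazurKenkuBound_of_radiusItem hRad

/-- A3: the stub from the Literature named fact (Mazur 1978 Thm 1 + Kenku 1982, list form). -/
theorem A3_stub_of_mazurKenku (hMK : mazurKenku_exists_cyclic_isogeny) :
    PastenShimura2024_minimalDegree_le_163_mul :=
  PastenShimura2024_minimalDegree_le_163_mul_of_mazurKenku' hMK

/-! ## Plan B — the Frey-restricted reshape (extremal instance of the composition)

`DefiniteRTControlPrime_of` applies the stub only at `W' = C • freyCurve a b` (full rational
`2`-torsion, `j > 0`, `j ∉ ℤ` unless `j = 1728`). -/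

/-- B0: the Frey-restricted stub (same conclusion, `W'` a global minimal model of a Frey curve). -/
def PastenFrey163 : Prop :=
  ∀ (a b : ℤ), IsCoprime a b → a * b * (a + b) ≠ 0 → ∀ (C : VariableChange ℚ)
    [(C • freyCurve a b).IsElliptic] [(C • freyCurve a b).IsGloballyMinimal]
    (N : ℕ) [NeZero N] (W : WeierstrassCurve ℚ) [W.IsElliptic]
    (D : ModularParametrizationData W N) (D' : ModularParametrizationData (C • freyCurve a b) N),
    D'.f = D.f →
    (∀ (W'' : WeierstrassCurve ℚ) [W''.IsElliptic] (D'' : ModularParametrizationData W'' N),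
      D''.f = D.f → D.modularDegree ≤ D''.modularDegree) →
    (∀ D'' : ModularParametrizationData (C • freyCurve a b) N,
      D'.modularDegree ≤ D''.modularDegree) →
    D'.modularDegree ≤ 163 * D.modularDegree

/-- B0 ⇐ stub (sanity: the reshape is a weakening). -/
theorem B0_of_stub (h : PastenShimura2024_minimalDegree_le_163_mul) : PastenFrey163 :=
  fun a b _ _ C _ _ N _ W _ D D' hf hmin hmin' ↦ h N W (C • freyCurve a b) D D' hf hmin hmin'

/-- B1 (S): `j` of a Frey curve is positive, and integral only when it is `1728`
(`j = 2⁸(a²+ab+b²)³/(ab(a+b))²`, `j_freyCurve`; `(a²+ab+b², ab(a+b)) = 1`). -/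
theorem B1_j_freyCurve_pos_nonint {a b : ℤ} (hab : IsCoprime a b) (h0 : a * b * (a + b) ≠ 0) :
    haveI := isElliptic_freyCurve h0
    0 < (freyCurve a b).j ∧ ((∃ z : ℤ, (freyCurve a b).j = z) → (freyCurve a b).j = 1728) := by
  sorry

/-- B2 (M): full rational `2`-torsion + a `Γ_ℚ`-stable CYCLIC subgroup of odd order `m` ⇒ the
`2`-neighbour `W/⟨Q⟩` carries a rational cyclic `4m`-isogeny (extract Darmon–Merel's `X₀(4p)`
construction from `hasIrreducibleModPGaloisRep_of_rational_two_torsion_of_mazurKenku`, prime `p`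
↦ odd `m`). -/
theorem B2_isCyclic_four_mul_of_rational_two_torsion (W W' : WeierstrassCurve ℚ) [W.IsElliptic]
    [W'.IsElliptic]
    (h2 : ∀ (σ : Field.absoluteGaloisGroup ℚ) (P : W.geomPoints), 2 • P = 0 → σ • P = P)
    (φ : Isogeny W W') (hφ : φ.IsCyclic) (hodd : Odd φ.degree) :
    ∃ (E₁ E₂ : WeierstrassCurve ℚ) (_ : E₁.IsElliptic) (_ : E₂.IsElliptic) (ψ : Isogeny E₁ E₂),
      IsIsogenous W E₁ ∧ ψ.IsCyclic ∧ ψ.degree = 4 * φ.degree := by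
  sorry

/-- B2' (S): full rational `2`-torsion + a cyclic isogeny of odd degree `m` out of `W` ⇒ a cyclic
`2m`-isogeny out of `W` itself (`⟨Q⟩ ⊕ ker φ`). -/
theorem B2'_isCyclic_two_mul_of_rational_two_torsion (W W' : WeierstrassCurve ℚ) [W.IsElliptic]
    [W'.IsElliptic]
    (h2 : ∀ (σ : Field.absoluteGaloisGroup ℚ) (P : W.geomPoints), 2 • P = 0 → σ • P = P)
    (φ : Isogeny W W') (hφ : φ.IsCyclic) (hodd : Odd φ.degree) :
    ∃ (E₂ : WeierstrassCurve ℚ) (_ : E₂.IsElliptic) (ψ : Isogeny W E₂),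
      ψ.IsCyclic ∧ ψ.degree = 2 * φ.degree := by
  sorry

/-- B3 (M): **Frey-class radius divides `144`** from the SMALLER bill {Cor. 4.4, prime `j`-table,
level `26`, `X₀(14)` table}; levels `20`, `32`, `27` and Prop. 5.1 are tree theorems. -/
theorem B3_freyRadius_dvd_144 (h44 : Mazur1978.cor44_valuation_j_le_one)
    (hT : primeDegreeIsogeny_jTable)
    (h26 : ∀ (V V' : WeierstrassCurve ℚ) [V.IsElliptic] [V'.IsElliptic] (ψ : Isogeny V V'),
      ψ.IsCyclic → ψ.degree ≠ 26)
    (h14 : ∀ (V V' : WeierstrassCurve ℚ) [V.IsElliptic] [V'.IsElliptic] (ψ : Isogeny V V'),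
      ψ.IsCyclic → ψ.degree = 14 → (ψ.degree, V.j) ∈ kenkuIsogenyJTable)
    {a b : ℤ} (hab : IsCoprime a b) (h0 : a * b * (a + b) ≠ 0) :
    haveI := isElliptic_freyCurve h0
    ∀ (W : WeierstrassCurve ℚ) [W.IsElliptic], IsIsogenous W (freyCurve a b) →
      ∃ φ : Isogeny W (freyCurve a b), φ.degree ∣ 144 := by
  sorry

/-- B4 (S/M): pointwise-radius version of the landed glue
`pastenShimura_minimalDegree_le_163_mul_of_radius` (its proof uses `hRad` only at curves
isogenous to `W'`), specialised to the Frey model; with B3 (`144 ≤ 163`) it gives B0. -/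
theorem B4_pastenFrey163_of_freyRadius
    (hRadF : ∀ (a b : ℤ), IsCoprime a b → (h0 : a * b * (a + b) ≠ 0) →
      haveI := isElliptic_freyCurve h0
      ∀ (W : WeierstrassCurve ℚ) [W.IsElliptic], IsIsogenous W (freyCurve a b) →
        ∃ φ : Isogeny W (freyCurve a b), φ.degree ≤ 163) :
    PastenFrey163 := by
  sorry

end Summit.ABC.ABC.Cruxes.DefiniteRTControlPrime.StubIdeas3

end
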